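import Literature.AlgebraicGeometry.AbelianVarieties.MarkmanDescentTwistProdTranslateCancel
import Literature.AlgebraicGeometry.AbelianVarieties.MarkmanPhiDescentTwistPullbackModel
import Literature.AlgebraicGeometry.AbelianVarieties.MarkmanPhiTranslateSnd
import Literature.AlgebraicGeometry.AbelianVarieties.MarkmanPhiBoxBridge
import Literature.AlgebraicGeometry.Modules.BoxTensorComplexTwoSided
import HarnessLib

/-!
# The box bridge for `Φ_T = Φ ⋙ (⊗ D′_s)⁺`: the exchange row
# `D⁺(t_{(x,x)}^*) ⋙ D⁺(p₂^*P_{α′}^∨ ⊗ –) ⋙ D⁺((t_a × 1)^*) ⋙ Φ_T ≅ Φ_T ⋙ D⁺(t_p^*)` on the family `a^{2s}β^{j} = 1`, `x = a^{j}β^{2s+1}`,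
# and the manufacture `e₂ : ι(Φ_T Q(R₂ ⊠ S₂)) ≅ Q𝓔 ↦ e₁ : ι(Φ_T Q((t_a^*t_x^*R₂) ⊠ (P_{α′}^∨ ⊗ t_x^*S₂))) ≅ Q(t_p^*𝓔)` (Markman 2025 §9.3; Mukai (3.1))

Layer `Literature/AlgebraicGeometry/AbelianVarieties`; sequel to `MarkmanPhiBoxBridge` (the same bridge for Markman's `Φ` without the descent twist:
ROW Φ-(iii) + `boxTensorComplexResolutionIso`), `MarkmanPhiTranslateSnd` (ROW Φ-(iv) `markmanPhi_diagTranslation_iso`: `D⁺(t_{(c,c)}^*) ⋙ Φ ≅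
Φ ⋙ D⁺(p_Â^*((P̂_{c⁻¹})^∨) ⊗ –)`), `MarkmanPhiDescentTwistPullbackModel` (`Φ_T := markmanPhiDescentTwistPlus A hΘ hK s j = Φ ⋙ (D′_s ⊗ –)⁺`) and
`MarkmanDescentTwistProdTranslateCancel` (the datum `ν : D′_s ⊗ t_p^*T_x ≅ t_p^*D′_s` under the cancellation equations). For a principally polarised
complex abelian variety `(A, Θ)` (`Â = A.dualOf Θ hΘ`), `s j : ℕ`, a complex point `p = (a, α′)` of `A × Â` (`β := φ_Θ⁻¹(α′)`) and a complex point `x` of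
`A` subject to **(E1) `a^{2s}·β^{j} = 1`** and **(E2) `a^{j}·β^{2s+1} = x`** (multiplicatively on `A(ℂ)`), this file PROVES (0 named facts, no instances):

* §1 (generic, `Modules` currency) **`tensorPullbackTensorIsoOfIso`**: from `ν : M′ ⊗ g^*L ≅ g^*M` the natural isomorphism
  `(L ⊗ –) ⋙ g^* ⋙ (M′ ⊗ –) ≅ (M ⊗ –) ⋙ g^*` (pull-back past a finite locally free tensor factor, twice, and the associator);
* §2 **THE EXCHANGE ROW FOR `Φ_T`** — `markmanPhiDescentTwist_exchange_iso_of_iso (ν)` and, with `ν` discharged by (E1)(E2),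
  **`markmanPhiDescentTwist_exchange_iso : D⁺(t_{(x,x)}^*) ⋙ D⁺(p₂^*P_{α′}^∨ ⊗ –) ⋙ D⁺((t_a × 1)^*) ⋙ Φ_T ≅ Φ_T ⋙ D⁺(t_p^*)`**: ROW Φ-(iii) at `p`
  carries `p₂^*P_{α′}^∨ ⊗ (t_a × 1)^*(–)` to `t_p^*`, ROW Φ-(iv) at `x` carries `t_{(x,x)}^*` to the twist `T_x = p_Â^*((P̂_{x⁻¹})^∨)`, and on `Mod 𝒪_{A×Â}`
  §1 at `ν` is `(T_x ⊗ –) ⋙ t_p^* ⋙ (D′_s ⊗ –) ≅ (D′_s ⊗ –) ⋙ t_p^*` (`mapDerivedCategoryPlusCompIso`, `mapDerivedCategoryPlusIsoOfIso`);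
* §3 the box side on `A × A`: **`boxTensorComplexDiagTranslationIso : (t_x^*•R) ⊠ (t_x^*•S) ≅ t_{(x,x)}^*•(R ⊠ S)`** (`pullbackBoxTensorComplexIso₂` along the
  squares `t_{(x,x)} ≫ pᵢ = pᵢ ≫ t_x`), the COROLLARY AT RESOLUTIONS `boxTensorComplexResolutionIso₃` whose left side is literally
  `((R₂.pullbackIso t_x).pullbackIso t_a).P ⊠ ((S₂.pullbackIso t_x).twist N).P`, and its reading `plusBoxTensorComplexResolutionIso₃` in `D⁺(Mod 𝒪_{A×A})`;
* §4 **THE MANUFACTURE `markmanPhiDescentTwist_boxIso_translate`** — from `e₂ : ι(Φ_T⟨Q(R₂.P ⊠ S₂.P), h₂⟩) ≅ Q𝓔` (ANY complex `𝓔` on `A × Â`) it RETURNS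
  `e₁ : ι(Φ_T⟨Q(((R₂.pullbackIso t_x).pullbackIso t_a).P ⊠ ((S₂.pullbackIso t_x).twist P_{α′}^∨).P), h₁⟩) ≅ Q(t_p^*•𝓔)` under (E1), (E2) (and the
  `ν`-form `…_of_iso`); every exactness instance is discharged inside.

Everything is typed on `A.X ⊗ A.X` ∕ `A.X ⊗ Â.X` with the projections `(fst _ _).left`, `(snd _ _).left`; the socket's `A.boxTensorComplex A R S` and
`translationPullbackComplex (A.prod Â) p 𝓔` are these terms by `rfl` (`AbelianVariety.prod_X`, `prodTranslationSchemeIso_hom`), `change`d ∕ `exact`ed by the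
consumer. NOT here: any statement that `Φ_T` is full or faithful, the vanishing (vi), the choice of `p` (the family is non-empty over every `a`:
`MarkmanDescentTwistProdTranslateCancel.exists_prodPoint_cancel`). Typed for the cell `pub-hodge-ring2` (the E1 step of design «(ii)+α′» for crux 26512's
socket v2: with E2 it manufactures the socket's `e₁` at `p = (a, α′)`, `a` free; a research route conditional on HC_CM, not a corollary — nothing in this
file refers to it).

## References

* E. Markman, *Cycles on abelian 2n-folds of Weil type from secant sheaves on abelian n-folds*, arXiv:2502.03415 (2025), §9.3 p. 71 L46–69
  (conjugating translations and Pic⁰-twists through `Φ̃`), Remark 9.3.7 (p. 73). [Markman2025SecantWeil]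
* S. Mukai, *Duality between `D(X)` and `D(X̂)` with its application to Picard sheaves*, Nagoya Math. J. 81 (1981), §3 (3.1) p. 158. [Mukai1981]
* The Stacks Project, Tag 0FXX (`K ⊠ M`), Tag 01CA (Lemma 17.16.1, 17.16.4). [StacksProject]
* C. A. Weibel, *An introduction to homological algebra* (1994), 10.5.2 (exact functors on `D`). [Weibel1994]
* U. Görtz, T. Wedhorn, *Algebraic Geometry II* (2023), Def./Rem. 27.1 (p. 799). [GortzWedhorn2023]
* R. Hartshorne, *Algebraic Geometry* (1977), III Prop. 6.7, Ex. 6.5, Prop. 9.3. [Hartshorne1977]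
-/

noncomputable section

-- `TopCat.Presheaf`/`Scheme.Modules` are not reducible (as in Mathlib's `AlgebraicGeometry/Modules/Sheaf.lean`).
set_option backward.isDefEq.respectTransparency false

open CategoryTheory CategoryTheory.Limits AlgebraicGeometry MonoidalCategory CartesianMonoidalCategory
open AlgebraicGeometry.Scheme.Modules

universe w₁ w₂ w₃ u

namespace Literature.AlgebraicGeometry.AbelianVarieties

open Literature.AlgebraicGeometry.Motives Literature.AlgebraicGeometry.Modules Literature.AlgebraicGeometry.KTheory
open scoped MonObj

/-! ### §1 `(L ⊗ –) ⋙ g^* ⋙ (M′ ⊗ –) ≅ (M ⊗ –) ⋙ g^*` from `M′ ⊗ g^*L ≅ g^*M` -/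

section ModuleFunctor

variable {Z Z' : Scheme.{u}} (g : Z' ⟶ Z) {L M : Z.Modules} {M' : Z'.Modules} (hL : IsFiniteLocallyFree L) (hM : IsFiniteLocallyFree M)

/-- **`(L ⊗ –) ⋙ g^* ⋙ (M′ ⊗ –) ≅ (M ⊗ –) ⋙ g^*` for finite locally free `L`, `M` on `Z` and an isomorphism `ν : M′ ⊗ g^*L ≅ g^*M` on `Z′`**:
`g^*(L ⊗ N) ≅ g^*L ⊗ g^*N` (`pullbackTensorNatIsoOfLeft`), the associator `M′ ⊗ (g^*L ⊗ –) ≅ (M′ ⊗ g^*L) ⊗ –` (`tensorLeftCompIso`), `ν`, and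
`g^*M ⊗ g^*(–) ≅ g^*(M ⊗ –)`. [cite: StacksProject, Tag 01CA (Lemma 17.16.1 and Lemma 17.16.4)] -/
def tensorPullbackTensorIsoOfIso (ν : tensorObj M' ((Scheme.Modules.pullback g).obj L) ≅ (Scheme.Modules.pullback g).obj M) :
    (tensorBifunctor Z).obj L ⋙ Scheme.Modules.pullback g ⋙ (tensorBifunctor Z').obj M' ≅
      (tensorBifunctor Z).obj M ⋙ Scheme.Modules.pullback g :=
  (Functor.associator _ _ _).symm ≪≫ Functor.isoWhiskerRight (pullbackTensorNatIsoOfLeft g hL) _ ≪≫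
    Functor.associator _ _ _ ≪≫
    Functor.isoWhiskerLeft (Scheme.Modules.pullback g)
      (tensorLeftCompIso M' ((Scheme.Modules.pullback g).obj L) ≪≫ (tensorBifunctor Z').mapIso ν) ≪≫
    (pullbackTensorNatIsoOfLeft g hM).symm

end ModuleFunctor

variable (A : AbelianVariety ℂ) {Θ : CartierDivisor A.X.left} (hΘ : Θ.IsAmple) (hK : A.KTheta Θ = ⊥)

/-! ### §2 The exchange row for `Φ_T` -/

section Row

variable (s j : ℕ) (p : (A.prod (A.dualOf Θ hΘ)).Points ℂ) (x : A.Points ℂ)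
  [HasDerivedCategory.{w₁} (A.X ⊗ A.X).left.Modules]
  [HasDerivedCategory.{w₂} ((A.X ⊗ A.X) ⊗ (A.dualOf Θ hΘ).X).left.Modules]
  [HasDerivedCategory.{w₃} (A.X ⊗ (A.dualOf Θ hΘ).X).left.Modules]

/-- **The exchange row for `Φ_T`, `ν`-form: `D⁺(t_{(x,x)}^*) ⋙ D⁺(p₂^*P_{α′}^∨ ⊗ –) ⋙ D⁺((t_a × 1)^*) ⋙ Φ_T ≅ Φ_T ⋙ D⁺(t_p^*)`** GIVEN an isomorphism
`ν : D′_s ⊗ t_p^*T_x ≅ t_p^*D′_s` on `A × Â` (`T_x = p_Â^*((P̂_{x⁻¹})^∨)`, `p = (a, α′)`, `a = p ≫ p₁`, `α′ = p ≫ p₂`): ROW Φ-(iii) at `p`, ROW Φ-(iv) at `x`, and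
§1 lifted to `D⁺` (`D⁺(T_x ⊗ –) ⋙ D⁺(t_p^*) ⋙ D⁺(D′_s ⊗ –) ≅ D⁺(D′_s ⊗ –) ⋙ D⁺(t_p^*)`). Exactness instances of the SOURCE functors are binders (as in the rows);
those of `T_x ⊗ –`, `D′_s ⊗ –` are discharged. [cite: Markman2025SecantWeil, §9.3 p. 71 L46–69 and Remark 9.3.7] [cite: Mukai1981, §3 (3.1) p. 158] [cite: Weibel1994, 10.5.2] -/
def markmanPhiDescentTwist_exchange_iso_of_iso
    (ν : tensorObj (descentTwist A hΘ hK s j)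
        ((Scheme.Modules.pullback (prodTranslationSchemeIso A (A.dualOf Θ hΘ) p).hom).obj
          ((Scheme.Modules.pullback (snd A.X (A.dualOf Θ hΘ).X).left).obj (Modules.dual (linePtHat A hΘ hK x⁻¹)))) ≅
      (Scheme.Modules.pullback (prodTranslationSchemeIso A (A.dualOf Θ hΘ) p).hom).obj (descentTwist A hΘ hK s j))
    [PreservesFiniteLimits (Scheme.Modules.pullback (prodTranslationSchemeIso A A (prodDiagPoint A x)).hom)]
    [((tensorBifunctor (A.X ⊗ A.X).left).obj ((Scheme.Modules.pullback (snd A.X A.X).left).obj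
      (Modules.dual (linePt A hΘ hK (p ≫ snd A.X (A.dualOf Θ hΘ).X))))).Additive]
    [PreservesFiniteLimits ((tensorBifunctor (A.X ⊗ A.X).left).obj ((Scheme.Modules.pullback (snd A.X A.X).left).obj
      (Modules.dual (linePt A hΘ hK (p ≫ snd A.X (A.dualOf Θ hΘ).X)))))]
    [PreservesFiniteColimits ((tensorBifunctor (A.X ⊗ A.X).left).obj ((Scheme.Modules.pullback (snd A.X A.X).left).obj
      (Modules.dual (linePt A hΘ hK (p ≫ snd A.X (A.dualOf Θ hΘ).X)))))]
    [PreservesFiniteLimits (Scheme.Modules.pullback (fstTranslationIso A (p ≫ fst A.X (A.dualOf Θ hΘ).X) A).hom)]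
    [PreservesFiniteLimits (Scheme.Modules.pullback (prodTranslationSchemeIso A (A.dualOf Θ hΘ) p).hom)] :
    (Scheme.Modules.pullback (prodTranslationSchemeIso A A (prodDiagPoint A x)).hom).mapDerivedCategoryPlus ⋙
      ((((tensorBifunctor (A.X ⊗ A.X).left).obj ((Scheme.Modules.pullback (snd A.X A.X).left).obj
          (Modules.dual (linePt A hΘ hK (p ≫ snd A.X (A.dualOf Θ hΘ).X))))).mapDerivedCategoryPlus ⋙
        (Scheme.Modules.pullback (fstTranslationIso A (p ≫ fst A.X (A.dualOf Θ hΘ).X) A).hom).mapDerivedCategoryPlus) ⋙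
        markmanPhiDescentTwistPlus A hΘ hK s j) ≅
      markmanPhiDescentTwistPlus A hΘ hK s j ⋙
        (Scheme.Modules.pullback (prodTranslationSchemeIso A (A.dualOf Θ hΘ) p).hom).mapDerivedCategoryPlus := by
  -- the exact functors in play and their exactness
  have hD := isFiniteLocallyFree_descentTwist A hΘ hK s j
  have hL : IsFiniteLocallyFree (Modules.dual (linePtHat A hΘ hK x⁻¹)) :=
    isFiniteLocallyFree_dual (isFiniteLocallyFree_linePtHat A hΘ hK x⁻¹)
  have hL₁ : HasRank (Modules.dual (linePtHat A hΘ hK x⁻¹)) 1 := hasRank_dual (hasRank_linePtHat A hΘ hK x⁻¹)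
  haveI := additive_tensorBifunctor_obj (descentTwist A hΘ hK s j)
  haveI := preservesFiniteLimits_tensor_descentTwist A hΘ hK s j
  haveI := preservesFiniteColimits_tensor_descentTwist A hΘ hK s j
  haveI := additive_tensorBifunctor_obj
    ((Scheme.Modules.pullback (snd A.X (A.dualOf Θ hΘ).X).left).obj (Modules.dual (linePtHat A hΘ hK x⁻¹)))
  haveI := (isInvertibleModule_of_hasRank_one (hL.pullback (snd A.X (A.dualOf Θ hΘ).X).left)
    (hasRank_pullback _ hL₁)).preservesFiniteLimits
  haveI := (isInvertibleModule_of_hasRank_one (hL.pullback (snd A.X (A.dualOf Θ hΘ).X).left)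
    (hasRank_pullback _ hL₁)).preservesFiniteColimits
  let Φ := markmanPhiPlus A hΘ hK
  let TD := (tensorBifunctor (A.X ⊗ (A.dualOf Θ hΘ).X).left).obj (descentTwist A hΘ hK s j)
  let Twx := (tensorBifunctor (A.X ⊗ (A.dualOf Θ hΘ).X).left).obj
    ((Scheme.Modules.pullback (snd A.X (A.dualOf Θ hΘ).X).left).obj (Modules.dual (linePtHat A hΘ hK x⁻¹)))
  let tp := Scheme.Modules.pullback (prodTranslationSchemeIso A (A.dualOf Θ hΘ) p).hom
  let txx := Scheme.Modules.pullback (prodTranslationSchemeIso A A (prodDiagPoint A x)).hom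
  let Src := ((tensorBifunctor (A.X ⊗ A.X).left).obj ((Scheme.Modules.pullback (snd A.X A.X).left).obj
      (Modules.dual (linePt A hΘ hK (p ≫ snd A.X (A.dualOf Θ hΘ).X))))).mapDerivedCategoryPlus ⋙
    (Scheme.Modules.pullback (fstTranslationIso A (p ≫ fst A.X (A.dualOf Θ hΘ).X) A).hom).mapDerivedCategoryPlus
  -- the key square on `Mod 𝒪_{A×Â}`, lifted to `D⁺`: `D⁺(Twx) ⋙ D⁺(tp) ⋙ D⁺(TD) ≅ D⁺(TD) ⋙ D⁺(tp)`
  let key : Twx.mapDerivedCategoryPlus ⋙ tp.mapDerivedCategoryPlus ⋙ TD.mapDerivedCategoryPlus ≅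
      TD.mapDerivedCategoryPlus ⋙ tp.mapDerivedCategoryPlus :=
    Functor.isoWhiskerLeft Twx.mapDerivedCategoryPlus (Functor.mapDerivedCategoryPlusCompIso tp TD).symm ≪≫
      (Functor.mapDerivedCategoryPlusCompIso Twx (tp ⋙ TD)).symm ≪≫
      Functor.mapDerivedCategoryPlusIsoOfIso _ _
        (tensorPullbackTensorIsoOfIso (prodTranslationSchemeIso A (A.dualOf Θ hΘ) p).hom
          (hL.pullback (snd A.X (A.dualOf Θ hΘ).X).left) hD ν) ≪≫
      Functor.mapDerivedCategoryPlusCompIso TD tp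
  change txx.mapDerivedCategoryPlus ⋙ (Src ⋙ (Φ ⋙ TD.mapDerivedCategoryPlus)) ≅
    (Φ ⋙ TD.mapDerivedCategoryPlus) ⋙ tp.mapDerivedCategoryPlus
  exact Functor.isoWhiskerLeft txx.mapDerivedCategoryPlus
      ((Functor.associator Src Φ TD.mapDerivedCategoryPlus).symm ≪≫
        Functor.isoWhiskerRight (markmanPhi_exchange_iso A hΘ hK p) TD.mapDerivedCategoryPlus ≪≫
        Functor.associator Φ tp.mapDerivedCategoryPlus TD.mapDerivedCategoryPlus) ≪≫
    (Functor.associator txx.mapDerivedCategoryPlus Φ (tp.mapDerivedCategoryPlus ⋙ TD.mapDerivedCategoryPlus)).symm ≪≫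
    Functor.isoWhiskerRight (markmanPhi_diagTranslation_iso A hΘ hK x) (tp.mapDerivedCategoryPlus ⋙ TD.mapDerivedCategoryPlus) ≪≫
    Functor.associator Φ Twx.mapDerivedCategoryPlus (tp.mapDerivedCategoryPlus ⋙ TD.mapDerivedCategoryPlus) ≪≫
    Functor.isoWhiskerLeft Φ key ≪≫
    (Functor.associator Φ TD.mapDerivedCategoryPlus tp.mapDerivedCategoryPlus).symm

/-- **THE EXCHANGE ROW FOR `Φ_T`: `D⁺(t_{(x,x)}^*) ⋙ D⁺(p₂^*P_{α′}^∨ ⊗ –) ⋙ D⁺((t_a × 1)^*) ⋙ Φ_T ≅ Φ_T ⋙ D⁺(t_p^*)`** on the family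
(E1) `a^{2s}·β^{j} = 1`, (E2) `a^{j}·β^{2s+1} = x` (`p = (a, α′)`, `β = φ_Θ⁻¹(α′)`): the `ν`-form at the chosen datum
`descentTwistTensorPullbackIsoOfCancel` of `MarkmanDescentTwistProdTranslateCancel` (identity (★) + the cancellation `t_p^*[T_x] = [N′_p]`). In words:
translating both factors of `A × A` by `x`, twisting the second by `P_{α′}^∨` and translating the first by `a` becomes, after `Φ_T`, the translation `t_p` of
`A × Â`. [cite: Markman2025SecantWeil, §9.3 p. 71 L46–69 and Remark 9.3.7] [cite: Mukai1981, §3 (3.1) p. 158] -/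
def markmanPhiDescentTwist_exchange_iso
    (h₁ : (p ≫ fst _ _) ^ (2 * s) * ((p ≫ snd _ _) ≫ phiThetaInv A hΘ hK) ^ j = 1)
    (h₂ : (p ≫ fst _ _) ^ j * ((p ≫ snd _ _) ≫ phiThetaInv A hΘ hK) ^ (2 * s + 1) = x)
    [PreservesFiniteLimits (Scheme.Modules.pullback (prodTranslationSchemeIso A A (prodDiagPoint A x)).hom)]
    [((tensorBifunctor (A.X ⊗ A.X).left).obj ((Scheme.Modules.pullback (snd A.X A.X).left).obj
      (Modules.dual (linePt A hΘ hK (p ≫ snd A.X (A.dualOf Θ hΘ).X))))).Additive]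
    [PreservesFiniteLimits ((tensorBifunctor (A.X ⊗ A.X).left).obj ((Scheme.Modules.pullback (snd A.X A.X).left).obj
      (Modules.dual (linePt A hΘ hK (p ≫ snd A.X (A.dualOf Θ hΘ).X)))))]
    [PreservesFiniteColimits ((tensorBifunctor (A.X ⊗ A.X).left).obj ((Scheme.Modules.pullback (snd A.X A.X).left).obj
      (Modules.dual (linePt A hΘ hK (p ≫ snd A.X (A.dualOf Θ hΘ).X)))))]
    [PreservesFiniteLimits (Scheme.Modules.pullback (fstTranslationIso A (p ≫ fst A.X (A.dualOf Θ hΘ).X) A).hom)]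
    [PreservesFiniteLimits (Scheme.Modules.pullback (prodTranslationSchemeIso A (A.dualOf Θ hΘ) p).hom)] :
    (Scheme.Modules.pullback (prodTranslationSchemeIso A A (prodDiagPoint A x)).hom).mapDerivedCategoryPlus ⋙
      ((((tensorBifunctor (A.X ⊗ A.X).left).obj ((Scheme.Modules.pullback (snd A.X A.X).left).obj
          (Modules.dual (linePt A hΘ hK (p ≫ snd A.X (A.dualOf Θ hΘ).X))))).mapDerivedCategoryPlus ⋙
        (Scheme.Modules.pullback (fstTranslationIso A (p ≫ fst A.X (A.dualOf Θ hΘ).X) A).hom).mapDerivedCategoryPlus) ⋙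
        markmanPhiDescentTwistPlus A hΘ hK s j) ≅
      markmanPhiDescentTwistPlus A hΘ hK s j ⋙
        (Scheme.Modules.pullback (prodTranslationSchemeIso A (A.dualOf Θ hΘ) p).hom).mapDerivedCategoryPlus :=
  markmanPhiDescentTwist_exchange_iso_of_iso A hΘ hK s j p x (descentTwistTensorPullbackIsoOfCancel A hΘ hK s j p x h₁ h₂)

end Row

/-! ### §3 The box side: `(t_x^*•R) ⊠ (t_x^*•S) ≅ t_{(x,x)}^*•(R ⊠ S)` and the corollary at resolutions -/

section Box

variable (x a : A.Points ℂ)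

/-- `t_{(x,x)} ≫ p₁ = p₁ ≫ t_x` on underlying schemes. [cite: GortzWedhorn2023, Def./Rem. 27.1 (p. 799)] -/
theorem prodDiagTranslation_hom_comp_fst :
    (prodTranslationSchemeIso A A (prodDiagPoint A x)).hom ≫ (fst A.X A.X).left = (fst A.X A.X).left ≫ (A.translation x).left := by
  rw [prodTranslationSchemeIso_hom, ← Over.comp_left, ← Over.comp_left, prodTranslation_comp_fst, prodDiagPoint_comp_fst]

/-- `t_{(x,x)} ≫ p₂ = p₂ ≫ t_x` on underlying schemes. [cite: GortzWedhorn2023, Def./Rem. 27.1 (p. 799)] -/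
theorem prodDiagTranslation_hom_comp_snd :
    (prodTranslationSchemeIso A A (prodDiagPoint A x)).hom ≫ (snd A.X A.X).left = (snd A.X A.X).left ≫ (A.translation x).left := by
  rw [prodTranslationSchemeIso_hom, ← Over.comp_left, ← Over.comp_left, prodTranslation_comp_snd, prodDiagPoint_comp_snd]

/-- **`(t_x^*•R) ⊠ (t_x^*•S) ≅ t_{(x,x)}^*•(R ⊠ S)`** as cochain complexes on `A × A`, for complexes `R`, `S` of vector bundles on `A`
(`Modules/BoxTensorComplexTwoSided.pullbackBoxTensorComplexIso₂` along the span automorphism `(t_{(x,x)}, t_x, t_x)`).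
[cite: StacksProject, Tag 0FXX and Tag 01CA (Lemma 17.16.4)] [cite: GortzWedhorn2023, Def./Rem. 27.1 (p. 799)] -/
def boxTensorComplexDiagTranslationIso (R S : CochainComplex A.X.left.Modules ℤ)
    (hR : ∀ i, IsFiniteLocallyFree (R.X i)) (hS : ∀ i, IsFiniteLocallyFree (S.X i)) :
    boxTensorComplex (fst A.X A.X).left (snd A.X A.X).left
        (((Scheme.Modules.pullback (A.translation x).left).mapHomologicalComplex (ComplexShape.up ℤ)).obj R)
        (((Scheme.Modules.pullback (A.translation x).left).mapHomologicalComplex (ComplexShape.up ℤ)).obj S) ≅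
      ((Scheme.Modules.pullback (prodTranslationSchemeIso A A (prodDiagPoint A x)).hom).mapHomologicalComplex
        (ComplexShape.up ℤ)).obj (boxTensorComplex (fst A.X A.X).left (snd A.X A.X).left R S) :=
  pullbackBoxTensorComplexIso₂ R S hR hS (prodDiagTranslation_hom_comp_fst A x) (prodDiagTranslation_hom_comp_snd A x)

/-- **The corollary at resolutions**: for strictly perfect resolutions `R₂`, `S₂` on `A` and an invertible finite locally free `N` on `A`,
`((R₂.pullbackIso t_x).pullbackIso t_a).P ⊠ ((S₂.pullbackIso t_x).twist N).P ≅ (t_a × 1)^*•((p₂^*N ⊗ –)•(t_{(x,x)}^*•(R₂.P ⊠ S₂.P)))` — the left side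
is the box of the resolutions of `t_a^*t_x^*G` and `N ⊗ t_x^*H` supplied by `StrictlyPerfectResolutionTwist` (`MarkmanPhiBoxBridge.boxTensorComplexResolutionIso`
at the translated resolutions, then `boxTensorComplexDiagTranslationIso`). [cite: StacksProject, Tag 0FXX] [cite: Hartshorne1977, III Prop. 6.7 and Ex. 6.5] -/
def boxTensorComplexResolutionIso₃ {G : A.X.left.Modules} (R₂ : StrictlyPerfectResolution G) {H : A.X.left.Modules}
    (S₂ : StrictlyPerfectResolution H) {N : A.X.left.Modules} (hN : IsFiniteLocallyFree N) (hInv : IsInvertibleModule N) :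
    haveI : ((tensorBifunctor (A.X ⊗ A.X).left).obj ((Scheme.Modules.pullback (snd A.X A.X).left).obj N)).Additive :=
      additive_tensorBifunctor_obj _
    boxTensorComplex (fst A.X A.X).left (snd A.X A.X).left
        ((R₂.pullbackIso (translationSchemeIso A x)).pullbackIso (translationSchemeIso A a)).P
        ((S₂.pullbackIso (translationSchemeIso A x)).twist hN hInv).P ≅
      ((Scheme.Modules.pullback (fstTranslationIso A a A).hom).mapHomologicalComplex (ComplexShape.up ℤ)).obj
        (((((tensorBifunctor (A.X ⊗ A.X).left).obj ((Scheme.Modules.pullback (snd A.X A.X).left).obj N)).mapHomologicalComplex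
          (ComplexShape.up ℤ)).obj
          (((Scheme.Modules.pullback (prodTranslationSchemeIso A A (prodDiagPoint A x)).hom).mapHomologicalComplex
            (ComplexShape.up ℤ)).obj (boxTensorComplex (fst A.X A.X).left (snd A.X A.X).left R₂.P S₂.P)))) :=
  haveI : ((tensorBifunctor (A.X ⊗ A.X).left).obj ((Scheme.Modules.pullback (snd A.X A.X).left).obj N)).Additive :=
    additive_tensorBifunctor_obj _
  boxTensorComplexResolutionIso A A a (R₂.pullbackIso (translationSchemeIso A x)) (S₂.pullbackIso (translationSchemeIso A x)) hN hInv ≪≫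
    ((Scheme.Modules.pullback (fstTranslationIso A a A).hom).mapHomologicalComplex (ComplexShape.up ℤ)).mapIso
      (((((tensorBifunctor (A.X ⊗ A.X).left).obj ((Scheme.Modules.pullback (snd A.X A.X).left).obj N)).mapHomologicalComplex
        (ComplexShape.up ℤ))).mapIso
        (boxTensorComplexDiagTranslationIso A x R₂.P S₂.P R₂.isBoundedVB.isFiniteLocallyFree S₂.isBoundedVB.isFiniteLocallyFree))

variable [HasDerivedCategory.{w₁} (A.X ⊗ A.X).left.Modules]

/-- **The same in `D⁺(Mod 𝒪_{A×A})`**: for `h : Q(R₂.P ⊠ S₂.P) ∈ D⁺` and `h' : Q(R₁.P ⊠ S₁.P) ∈ D⁺`,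
`⟨Q(R₁.P ⊠ S₁.P), h'⟩ ≅ (D⁺(t_{(x,x)}^*) ⋙ D⁺(p₂^*N ⊗ –) ⋙ D⁺((t_a × 1)^*))⟨Q(R₂.P ⊠ S₂.P), h⟩` (`Q` of §3, Mathlib's `mapDerivedCategoryFactors` for
the three exact functors, `Plus.ι` fully faithful; exactness instances are binders). [cite: Weibel1994, 10.5.2] [cite: StacksProject, Tag 0FXX] -/
def plusBoxTensorComplexResolutionIso₃ {G : A.X.left.Modules} (R₂ : StrictlyPerfectResolution G) {H : A.X.left.Modules}
    (S₂ : StrictlyPerfectResolution H) {N : A.X.left.Modules} (hN : IsFiniteLocallyFree N) (hInv : IsInvertibleModule N)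
    [((tensorBifunctor (A.X ⊗ A.X).left).obj ((Scheme.Modules.pullback (snd A.X A.X).left).obj N)).Additive]
    [PreservesFiniteLimits ((tensorBifunctor (A.X ⊗ A.X).left).obj ((Scheme.Modules.pullback (snd A.X A.X).left).obj N))]
    [PreservesFiniteColimits ((tensorBifunctor (A.X ⊗ A.X).left).obj ((Scheme.Modules.pullback (snd A.X A.X).left).obj N))]
    [PreservesFiniteLimits (Scheme.Modules.pullback (fstTranslationIso A a A).hom)]
    [PreservesFiniteLimits (Scheme.Modules.pullback (prodTranslationSchemeIso A A (prodDiagPoint A x)).hom)]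
    (h : DerivedCategory.TStructure.t.plus
      (DerivedCategory.Q.obj (boxTensorComplex (fst A.X A.X).left (snd A.X A.X).left R₂.P S₂.P)))
    (h' : DerivedCategory.TStructure.t.plus
      (DerivedCategory.Q.obj (boxTensorComplex (fst A.X A.X).left (snd A.X A.X).left
        ((R₂.pullbackIso (translationSchemeIso A x)).pullbackIso (translationSchemeIso A a)).P
        ((S₂.pullbackIso (translationSchemeIso A x)).twist hN hInv).P))) :
    (⟨_, h'⟩ : DerivedCategory.Plus (A.X ⊗ A.X).left.Modules) ≅
      ((Scheme.Modules.pullback (prodTranslationSchemeIso A A (prodDiagPoint A x)).hom).mapDerivedCategoryPlus ⋙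
        (((tensorBifunctor (A.X ⊗ A.X).left).obj ((Scheme.Modules.pullback (snd A.X A.X).left).obj N)).mapDerivedCategoryPlus ⋙
          (Scheme.Modules.pullback (fstTranslationIso A a A).hom).mapDerivedCategoryPlus)).obj ⟨_, h⟩ :=
  let ta := Scheme.Modules.pullback (fstTranslationIso A a A).hom
  let Tw := (tensorBifunctor (A.X ⊗ A.X).left).obj ((Scheme.Modules.pullback (snd A.X A.X).left).obj N)
  let txx := Scheme.Modules.pullback (prodTranslationSchemeIso A A (prodDiagPoint A x)).hom
  DerivedCategory.Plus.ι.preimageIso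
    (DerivedCategory.Q.mapIso (boxTensorComplexResolutionIso₃ A x a R₂ S₂ hN hInv) ≪≫
      (ta.mapDerivedCategoryFactors.app _).symm ≪≫
      ta.mapDerivedCategory.mapIso
        ((Tw.mapDerivedCategoryFactors.app _).symm ≪≫
          Tw.mapDerivedCategory.mapIso
            ((txx.mapDerivedCategoryFactors.app _).symm ≪≫ ((Functor.mapDerivedCategoryPlusCompιIso txx).app ⟨_, h⟩).symm) ≪≫
          ((Functor.mapDerivedCategoryPlusCompιIso Tw).app _).symm) ≪≫
      ((Functor.mapDerivedCategoryPlusCompιIso ta).app _).symm)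

end Box

/-! ### §4 The manufacture `e₂ ↦ e₁` for `Φ_T` -/

section Manufacture

variable (s j : ℕ) (p : (A.prod (A.dualOf Θ hΘ)).Points ℂ) (x : A.Points ℂ)
  [HasDerivedCategory.{w₁} (A.X ⊗ A.X).left.Modules]
  [HasDerivedCategory.{w₂} ((A.X ⊗ A.X) ⊗ (A.dualOf Θ hΘ).X).left.Modules]
  [HasDerivedCategory.{w₃} (A.X ⊗ (A.dualOf Θ hΘ).X).left.Modules]

/-- **`e₂ ↦ e₁` for `Φ_T`, `ν`-form**: for `p = (a, α′)`, `x`, an isomorphism `ν : D′_s ⊗ t_p^*T_x ≅ t_p^*D′_s`, strictly perfect resolutions `R₂`, `S₂` on `A`, a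
complex `𝓔` on `A × Â` and `e₂ : ι(Φ_T⟨Q(R₂.P ⊠ S₂.P), h₂⟩) ≅ Q𝓔` (`Φ_T = markmanPhiDescentTwistPlus A hΘ hK s j`), the isomorphism
**`e₁ : ι(Φ_T⟨Q(((R₂.pullbackIso t_x).pullbackIso t_a).P ⊠ ((S₂.pullbackIso t_x).twist P_{α′}^∨).P), h₁⟩) ≅ Q(t_p^*•𝓔)`** (§3 in `D⁺`, §2 at `p`, `x`,
and `D(t_p^*) ∘ Q ≅ Q ∘ t_p^*•`). All exactness instances are discharged here. [cite: Markman2025SecantWeil, §9.3 p. 71 L46–69 and Remark 9.3.7]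
[cite: Mukai1981, §3 (3.1) p. 158] -/
def markmanPhiDescentTwist_boxIso_translate_of_iso
    (ν : tensorObj (descentTwist A hΘ hK s j)
        ((Scheme.Modules.pullback (prodTranslationSchemeIso A (A.dualOf Θ hΘ) p).hom).obj
          ((Scheme.Modules.pullback (snd A.X (A.dualOf Θ hΘ).X).left).obj (Modules.dual (linePtHat A hΘ hK x⁻¹)))) ≅
      (Scheme.Modules.pullback (prodTranslationSchemeIso A (A.dualOf Θ hΘ) p).hom).obj (descentTwist A hΘ hK s j))
    {G : A.X.left.Modules} (R₂ : StrictlyPerfectResolution G) {H : A.X.left.Modules} (S₂ : StrictlyPerfectResolution H)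
    (𝓔 : CochainComplex (A.X ⊗ (A.dualOf Θ hΘ).X).left.Modules ℤ)
    (h₂ : DerivedCategory.TStructure.t.plus
      (DerivedCategory.Q.obj (boxTensorComplex (fst A.X A.X).left (snd A.X A.X).left R₂.P S₂.P)))
    (h₁ : DerivedCategory.TStructure.t.plus
      (DerivedCategory.Q.obj (boxTensorComplex (fst A.X A.X).left (snd A.X A.X).left
        ((R₂.pullbackIso (translationSchemeIso A x)).pullbackIso
          (translationSchemeIso A (p ≫ fst A.X (A.dualOf Θ hΘ).X))).P
        ((S₂.pullbackIso (translationSchemeIso A x)).twist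
          (isFiniteLocallyFree_dual (isFiniteLocallyFree_linePt A hΘ hK (p ≫ snd A.X (A.dualOf Θ hΘ).X)))
          (isInvertibleModule_of_hasRank_one
            (isFiniteLocallyFree_dual (isFiniteLocallyFree_linePt A hΘ hK (p ≫ snd A.X (A.dualOf Θ hΘ).X)))
            (hasRank_dual (hasRank_linePt A hΘ hK (p ≫ snd A.X (A.dualOf Θ hΘ).X))))).P)))
    (e₂ : DerivedCategory.Plus.ι.obj ((markmanPhiDescentTwistPlus A hΘ hK s j).obj ⟨_, h₂⟩) ≅ DerivedCategory.Q.obj 𝓔) :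
    DerivedCategory.Plus.ι.obj ((markmanPhiDescentTwistPlus A hΘ hK s j).obj ⟨_, h₁⟩) ≅
      DerivedCategory.Q.obj (((Scheme.Modules.pullback (prodTranslationSchemeIso A (A.dualOf Θ hΘ) p).hom).mapHomologicalComplex
        (ComplexShape.up ℤ)).obj 𝓔) := by
  let a : A.Points ℂ := p ≫ fst A.X (A.dualOf Θ hΘ).X
  let α : (A.dualOf Θ hΘ).Points ℂ := p ≫ snd A.X (A.dualOf Θ hΘ).X
  have hN : IsFiniteLocallyFree (Modules.dual (linePt A hΘ hK α)) := isFiniteLocallyFree_dual (isFiniteLocallyFree_linePt A hΘ hK α)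
  have hN₁ : HasRank (Modules.dual (linePt A hΘ hK α)) 1 := hasRank_dual (hasRank_linePt A hΘ hK α)
  haveI := additive_tensorBifunctor_obj ((Scheme.Modules.pullback (snd A.X A.X).left).obj (Modules.dual (linePt A hΘ hK α)))
  haveI := (isInvertibleModule_of_hasRank_one (hN.pullback (snd A.X A.X).left) (hasRank_pullback _ hN₁)).preservesFiniteLimits
  haveI := (isInvertibleModule_of_hasRank_one (hN.pullback (snd A.X A.X).left) (hasRank_pullback _ hN₁)).preservesFiniteColimits
  haveI := preservesFiniteLimits_pullback_fstTranslation A a A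
  haveI := preservesFiniteLimits_pullback_prodTranslation A (A.dualOf Θ hΘ) p
  haveI := preservesFiniteLimits_pullback_prodTranslation A A (prodDiagPoint A x)
  let Φ := markmanPhiDescentTwistPlus A hΘ hK s j
  let tp := Scheme.Modules.pullback (prodTranslationSchemeIso A (A.dualOf Θ hΘ) p).hom
  -- `X₁ ≅ (D⁺(t_{(x,x)}^*) ⋙ D⁺(T_N) ⋙ D⁺((t_a × 1)^*)) X₂` in `D⁺(Mod 𝒪_{A×A})`
  let e₁₂ := plusBoxTensorComplexResolutionIso₃ A x a R₂ S₂ hN (isInvertibleModule_of_hasRank_one hN hN₁) h₂ h₁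
  -- through `Φ_T` and the exchange row, then down to `D` along `ι`, `e₂`, and the factorisation of `D(t_p^*)` through `Q`
  exact DerivedCategory.Plus.ι.mapIso (Φ.mapIso e₁₂ ≪≫ (markmanPhiDescentTwist_exchange_iso_of_iso A hΘ hK s j p x ν).app ⟨_, h₂⟩) ≪≫
    (Functor.mapDerivedCategoryPlusCompιIso tp).app _ ≪≫ tp.mapDerivedCategory.mapIso e₂ ≪≫ tp.mapDerivedCategoryFactors.app 𝓔

/-- **`e₂ ↦ e₁` FOR `Φ_T` ON THE FAMILY (E1) `a^{2s}·β^{j} = 1`, (E2) `a^{j}·β^{2s+1} = x`** (`p = (a, α′)`, `β = φ_Θ⁻¹(α′)`): from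
`e₂ : ι(Φ_T⟨Q(R₂.P ⊠ S₂.P), h₂⟩) ≅ Q𝓔` the isomorphism **`e₁ : ι(Φ_T⟨Q(((R₂.pullbackIso t_x).pullbackIso t_a).P ⊠ ((S₂.pullbackIso t_x).twist P_{α′}^∨).P), h₁⟩) ≅
Q(t_p^*•𝓔)`** — the box of the resolutions of `t_a^*t_x^*G` and `P_{α′}^∨ ⊗ t_x^*H` goes to the translate of `𝓔` by `p` (the `ν`-form at
`descentTwistTensorPullbackIsoOfCancel`). [cite: Markman2025SecantWeil, §9.3 p. 71 L46–69 and Remark 9.3.7] [cite: Mukai1981, §3 (3.1) p. 158] -/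
def markmanPhiDescentTwist_boxIso_translate
    (h₁ : (p ≫ fst _ _) ^ (2 * s) * ((p ≫ snd _ _) ≫ phiThetaInv A hΘ hK) ^ j = 1)
    (h₂ : (p ≫ fst _ _) ^ j * ((p ≫ snd _ _) ≫ phiThetaInv A hΘ hK) ^ (2 * s + 1) = x)
    {G : A.X.left.Modules} (R₂ : StrictlyPerfectResolution G) {H : A.X.left.Modules} (S₂ : StrictlyPerfectResolution H)
    (𝓔 : CochainComplex (A.X ⊗ (A.dualOf Θ hΘ).X).left.Modules ℤ)
    (h₂' : DerivedCategory.TStructure.t.plus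
      (DerivedCategory.Q.obj (boxTensorComplex (fst A.X A.X).left (snd A.X A.X).left R₂.P S₂.P)))
    (h₁' : DerivedCategory.TStructure.t.plus
      (DerivedCategory.Q.obj (boxTensorComplex (fst A.X A.X).left (snd A.X A.X).left
        ((R₂.pullbackIso (translationSchemeIso A x)).pullbackIso
          (translationSchemeIso A (p ≫ fst A.X (A.dualOf Θ hΘ).X))).P
        ((S₂.pullbackIso (translationSchemeIso A x)).twist
          (isFiniteLocallyFree_dual (isFiniteLocallyFree_linePt A hΘ hK (p ≫ snd A.X (A.dualOf Θ hΘ).X)))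
          (isInvertibleModule_of_hasRank_one
            (isFiniteLocallyFree_dual (isFiniteLocallyFree_linePt A hΘ hK (p ≫ snd A.X (A.dualOf Θ hΘ).X)))
            (hasRank_dual (hasRank_linePt A hΘ hK (p ≫ snd A.X (A.dualOf Θ hΘ).X))))).P)))
    (e₂ : DerivedCategory.Plus.ι.obj ((markmanPhiDescentTwistPlus A hΘ hK s j).obj ⟨_, h₂'⟩) ≅ DerivedCategory.Q.obj 𝓔) :
    DerivedCategory.Plus.ι.obj ((markmanPhiDescentTwistPlus A hΘ hK s j).obj ⟨_, h₁'⟩) ≅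
      DerivedCategory.Q.obj (((Scheme.Modules.pullback (prodTranslationSchemeIso A (A.dualOf Θ hΘ) p).hom).mapHomologicalComplex
        (ComplexShape.up ℤ)).obj 𝓔) :=
  markmanPhiDescentTwist_boxIso_translate_of_iso A hΘ hK s j p x (descentTwistTensorPullbackIsoOfCancel A hΘ hK s j p x h₁ h₂) R₂ S₂ 𝓔
    h₂' h₁' e₂

end Manufacture

end Literature.AlgebraicGeometry.AbelianVarieties

end
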